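import Literature.NumberTheory.GaloisRepresentations.HeckeCharacterAutConj
import Mathlib.NumberTheory.NumberField.Units.DirichletTheorem
import HarnessLib

/-!
# Purity of algebraic Hecke characters: the weight `n_φ + n_φ̄ = w` (Weil; proofs)

Topic `NumberTheory/GaloisRepresentations`; namespace `Literature.NumberTheory.GaloisRepresentations`.
Proof file (theorems only: no definition, no named fact, no instance). Let `χ` be a Hecke character
of the number field `K` with infinity type `(p, q)` in the sense of the tree
(`HeckeCharacter.HasInfinityType χ p q`: `χ((x, 1)) = ∏_w ι_w(x_w)^{-p_w} \overline{ι_w(x_w)}^{-q_w}`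
near `1`; exponent `n_φ = embExponent p q φ` of the embedding `φ : K → ℂ`, i.e. `p_w + q_w` at a
real place, `p_w` at `σ_w` and `q_w` at `σ̄_w` at a complex place). This file proves **purity**:
there is an integer `w`, the *weight* of `χ`, with `n_φ + n_{φ̄} = w` for every embedding `φ`
(`HasInfinityType.exists_embExponent_add_conjugate_eq`), equivalently `2 (p_w + q_w) = w · [K_w : ℝ]`
at every infinite place (`HasInfinityType.exists_two_mul_add_eq_weight_mul_mult`), following the
printed argument (Patrikis 2019, proof of Lemma 2.1.3 = Weil 1956, "left as an exercise"; the unit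
criterion is Patrikis's Lemma 2.1.1):

1. `HasInfinityType.prod_embedding_unit_pow_eq_one` — **the unit relation**: for some `M ≥ 1` and
   every global unit `u`, `∏_w σ_w(u^M)^{p_w} \overline{σ_w(u^M)}^{q_w} = 1`. (The tree's
   Größencharakter identity `HasInfinityType.idealPow_span_eq` for the principal ideals `(u^{2N}) = (1)`
   with `u^N ≡ 1 mod 𝔪`, `𝔪` a module of definition, `N = |(𝓞_K/𝔪)ˣ|`.)
2. `HasInfinityType.sum_mul_log_unit_eq_zero` — taking `log |·|`:
   `∑_w (p_w + q_w) log |u|_w = 0` for every unit `u`.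
3. `exists_eq_mul_mult_of_sum_mul_log_unit_eq_zero` — **Dirichlet's unit theorem** (Mathlib: the
   logarithmic embedding of the units spans the trace-zero hyperplane,
   `NumberField.Units.dirichletUnitTheorem.unitLattice_span_eq_top`): a real relation
   `∑_w c_w log |u|_w = 0` for all units forces `c_w = κ · [K_w : ℝ]`.
4. Integrality: `2 (p_w + q_w) = w · [K_w : ℝ]` with `w ∈ ℤ`, and the embedding form
   `n_φ + n_φ̄ = w`; `weight_autConjType_eq` — the conjugate types `^σ(p, q)` (`autConjType`,
   `HeckeCharacterAutConj`) have the same weight.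

## References

* S. Patrikis, *Variations on a theorem of Tate*, Mem. AMS 258 (2019) = arXiv:1207.6724, §2.1,
  Lemma 2.1.1 and proof of Lemma 2.1.3. [Patrikis2019]
* A. Weil, *On a certain type of characters of the idèle-class group of an algebraic
  number-field* (1956). [Weil1956]
-/

noncomputable section

open scoped NumberField ComplexConjugate Classical
open NumberField IsDedekindDomain NumberField.InfinitePlace

namespace Literature.NumberTheory.GaloisRepresentations

universe u

variable {K : Type u} [Field K] [NumberField K]

namespace HeckeCharacter

/-! ### §1. The unit relation -/

/-- For a nonzero ideal `𝔪` of `𝓞 K` there is `M ≥ 1` with `u^M ≡ 1 mod 𝔪` for every unit `u`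
(`M = |(𝓞_K/𝔪)ˣ|`). [folklore] -/
theorem exists_unit_pow_sub_one_mem (𝔪 : Ideal (𝓞 K)) (h𝔪 : 𝔪 ≠ ⊥) :
    ∃ M : ℕ, 0 < M ∧ ∀ u : (𝓞 K)ˣ, (u : 𝓞 K) ^ M - 1 ∈ 𝔪 := by
  haveI : Finite (𝓞 K ⧸ 𝔪) := Ideal.finiteQuotientOfFreeOfNeBot 𝔪 h𝔪
  refine ⟨Nat.card (𝓞 K ⧸ 𝔪)ˣ, Nat.card_pos, fun u ↦ ?_⟩
  rw [← Ideal.Quotient.eq_zero_iff_mem, map_sub, map_one, map_pow, sub_eq_zero]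
  have h : (Units.map (Ideal.Quotient.mk 𝔪 : 𝓞 K →* 𝓞 K ⧸ 𝔪) u) ^ Nat.card (𝓞 K ⧸ 𝔪)ˣ = 1 :=
    pow_card_eq_one'
  have h' := congrArg Units.val h
  rwa [Units.val_pow_eq_pow_val, Units.coe_map, Units.val_one] at h'

/-- **The unit relation of an algebraic Hecke character** (Patrikis 2019, Lemma 2.1.1, for type
`A₀`): if `χ` has infinity type `(p, q)` then for some `M ≥ 1`,
`∏_w σ_w(u^M)^{p_w} \overline{σ_w(u^M)}^{q_w} = 1` for every unit `u ∈ 𝓞_Kˣ`. (Größencharakter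
identity `idealPow_span_eq` of the tree on `(u^{2N}) = (1)`, `u^N ≡ 1 mod 𝔪`.)
[cite: Patrikis2019, Lemma 2.1.1 (arXiv:1207.6724 §2.1)] -/
theorem HasInfinityType.prod_embedding_unit_pow_eq_one {χ : HeckeCharacter K}
    {p q : InfinitePlace K → ℤ} (h : χ.HasInfinityType p q) :
    ∃ M : ℕ, 0 < M ∧ ∀ u : (𝓞 K)ˣ,
      ∏ w : InfinitePlace K, w.embedding (((u : 𝓞 K) : K) ^ M) ^ (p w) *
        conj (w.embedding (((u : 𝓞 K) : K) ^ M)) ^ (q w) = 1 := by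
  obtain ⟨T, e, hmod⟩ := χ.exists_isModulus
  obtain ⟨N, hN, hcong⟩ := exists_unit_pow_sub_one_mem (modulusIdeal T e) (modulusIdeal_ne_bot T e)
  refine ⟨2 * N, by omega, fun u ↦ ?_⟩
  set a : 𝓞 K := (u : 𝓞 K) ^ N with ha
  have ha0 : a ≠ 0 := pow_ne_zero _ (Units.ne_zero u)
  have hb : a * a ≠ 0 := mul_ne_zero ha0 ha0
  have hc : (1 : 𝓞 K) ≠ 0 := one_ne_zero
  have hcop : IsCoprime (Ideal.span {(1 : 𝓞 K)}) (modulusIdeal T e) := by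
    rw [Ideal.span_singleton_one, ← Ideal.one_eq_top]
    exact isCoprime_one_left
  have hbc : a * a - 1 ∈ modulusIdeal T e := by
    have e1 : a * a - 1 = (a - 1) * (a + 1) := by ring
    rw [e1]
    exact Ideal.mul_mem_right _ _ (hcong u)
  have hpos : ∀ φ : K →+* ℝ, 0 < φ ((a * a : 𝓞 K) : K) * φ ((1 : 𝓞 K) : K) := by
    intro φ
    have hφa : φ (a : K) ≠ 0 :=
      (map_ne_zero φ).mpr (by exact_mod_cast ha0)
    push_cast
    rw [map_mul, map_one, mul_one]
    exact mul_self_pos.mpr hφa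
  have key := h.idealPow_span_eq hmod hb hc hcop hbc hpos
  have hunit : IsUnit (a * a) := by
    rw [ha, ← pow_add, ← Units.val_pow_eq_pow_val]
    exact Units.isUnit _
  rw [Ideal.span_singleton_eq_top.mpr hunit, Ideal.span_singleton_one, LFunctions.idealPow_top,
    one_mul] at key
  have hx : ((a * a : 𝓞 K) : K) / ((1 : 𝓞 K) : K) = ((u : 𝓞 K) : K) ^ (2 * N) := by
    push_cast
    rw [div_one, ha]
    push_cast
    ring
  rw [hx] at key
  exact key.symm

/-! ### §2. Taking logarithms: `∑_w (p_w + q_w) log |u|_w = 0` -/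

/-- **The logarithmic unit relation**: if `χ` has infinity type `(p, q)` then
`∑_w (p_w + q_w) log |u|_w = 0` for every unit `u` (apply `log |·|` to
`prod_embedding_unit_pow_eq_one`; `|σ_w(u)| = |\overline{σ_w(u)}| = |u|_w`). Patrikis 2019, proof
of Lemma 2.1.3 ("applying `log |ι(·)|`"). [cite: Patrikis2019, proof of Lemma 2.1.3 (arXiv:1207.6724 §2.1)] -/
theorem HasInfinityType.sum_mul_log_unit_eq_zero {χ : HeckeCharacter K} {p q : InfinitePlace K → ℤ}
    (h : χ.HasInfinityType p q) (u : (𝓞 K)ˣ) :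
    ∑ w : InfinitePlace K, ((p w + q w : ℤ) : ℝ) * Real.log (w ((u : 𝓞 K) : K)) = 0 := by
  obtain ⟨M, hM, hprod⟩ := h.prod_embedding_unit_pow_eq_one
  have hu0 : ((u : 𝓞 K) : K) ≠ 0 := by exact_mod_cast Units.ne_zero u
  have hwpos : ∀ w : InfinitePlace K, 0 < w ((u : 𝓞 K) : K) := fun w ↦ pos_iff.mpr hu0
  have hterm : ∀ w : InfinitePlace K,
      ‖w.embedding (((u : 𝓞 K) : K) ^ M) ^ (p w) * conj (w.embedding (((u : 𝓞 K) : K) ^ M)) ^ (q w)‖ =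
        (w ((u : 𝓞 K) : K) ^ M) ^ (p w + q w) := by
    intro w
    rw [norm_mul, norm_zpow, norm_zpow, Complex.norm_conj, map_pow, norm_pow, norm_embedding_eq,
      ← zpow_add₀ (pow_ne_zero _ (hwpos w).ne')]
  have hne : ∀ w ∈ (Finset.univ : Finset (InfinitePlace K)),
      ‖w.embedding (((u : 𝓞 K) : K) ^ M) ^ (p w) * conj (w.embedding (((u : 𝓞 K) : K) ^ M)) ^ (q w)‖ ≠ 0 := by
    intro w _
    rw [hterm]
    exact zpow_ne_zero _ (pow_ne_zero _ (hwpos w).ne')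
  have key : Real.log ‖∏ w : InfinitePlace K, w.embedding (((u : 𝓞 K) : K) ^ M) ^ (p w) *
      conj (w.embedding (((u : 𝓞 K) : K) ^ M)) ^ (q w)‖ = 0 := by
    rw [hprod u, norm_one, Real.log_one]
  rw [norm_prod, Real.log_prod hne] at key
  simp_rw [hterm, Real.log_zpow, Real.log_pow] at key
  have key' : (M : ℝ) * ∑ w : InfinitePlace K, ((p w + q w : ℤ) : ℝ) * Real.log (w ((u : 𝓞 K) : K)) = 0 := by
    rw [Finset.mul_sum, ← key]
    refine Finset.sum_congr rfl fun w _ ↦ ?_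
    ring
  exact (mul_eq_zero.mp key').resolve_left (by exact_mod_cast hM.ne')

/-! ### §3. Dirichlet's unit theorem: linear relations among the `log |u|_w` -/

open NumberField.Units NumberField.Units.dirichletUnitTheorem in
/-- **Linear relations among the logarithms of units are multiples of the product formula**
(Dirichlet's unit theorem): if real numbers `c_w` satisfy `∑_w c_w log |u|_w = 0` for every unit
`u ∈ 𝓞_Kˣ`, then `c_w = κ [K_w : ℝ]` for one real `κ` — the logarithmic embedding of the units
spans the hyperplane `∑_w [K_w : ℝ] x_w = 0` (Mathlib `unitLattice_span_eq_top`, in the coordinates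
omitting `w₀`). Patrikis 2019, proof of Lemma 2.1.3 ("which by the unit theorem is only possible
when … equals a constant"). [cite: Patrikis2019, proof of Lemma 2.1.3 (arXiv:1207.6724 §2.1)] -/
theorem exists_eq_mul_mult_of_sum_mul_log_unit_eq_zero (c : InfinitePlace K → ℝ)
    (hc : ∀ u : (𝓞 K)ˣ, ∑ w : InfinitePlace K, c w * Real.log (w ((u : 𝓞 K) : K)) = 0) :
    ∃ κ : ℝ, ∀ w : InfinitePlace K, c w = κ * w.mult := by
  have hm0 : ∀ w : InfinitePlace K, (w.mult : ℝ) ≠ 0 := fun w ↦ by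
    have : 0 < w.mult := by rw [mult]; split_ifs <;> norm_num
    exact_mod_cast this.ne'
  set κ : ℝ := c w₀ / (w₀ : InfinitePlace K).mult with hκ
  have hκ0 : κ * (w₀ : InfinitePlace K).mult = c w₀ := div_mul_cancel₀ _ (hm0 _)
  refine ⟨κ, fun w ↦ ?_⟩
  by_cases hw : w = w₀
  · rw [hw, hκ0]
  · -- the linear form `f(y) = ∑_{w' ≠ w₀} (c_{w'} / [K_{w'}:ℝ] - κ) y_{w'}` on the log space
    let coef : {w : InfinitePlace K // w ≠ w₀} → ℝ := fun w' ↦ c w'.1 / w'.1.mult - κ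
    let f : logSpace K →ₗ[ℝ] ℝ :=
      { toFun := fun y ↦ ∑ w', coef w' * y w'
        map_add' := fun y z ↦ by
          simp only [Pi.add_apply, mul_add, Finset.sum_add_distrib]
        map_smul' := fun r y ↦ by
          simp only [Pi.smul_apply, smul_eq_mul, RingHom.id_apply, Finset.mul_sum]
          exact Finset.sum_congr rfl fun _ _ ↦ by ring }
    have hf_apply : ∀ y : logSpace K, f y = ∑ w', coef w' * y w' := fun _ ↦ rfl
    -- `f` kills the unit lattice
    have hf : ∀ y ∈ (unitLattice K : Set (logSpace K)), f y = 0 := by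
      rintro _ ⟨x, -, rfl⟩
      have hx : ∀ w' : {w : InfinitePlace K // w ≠ w₀},
          ((logEmbedding K).toIntLinearMap x) w' = mult w'.1 * Real.log (w'.1 (((Additive.toMul x : (𝓞 K)ˣ) : 𝓞 K) : K)) :=
        fun w' ↦ rfl
      rw [hf_apply]
      simp_rw [hx]
      have h1 : ∑ w' : {w : InfinitePlace K // w ≠ w₀}, coef w' * (mult w'.1 * Real.log (w'.1 (((Additive.toMul x : (𝓞 K)ˣ) : 𝓞 K) : K))) =
          (∑ w' : {w : InfinitePlace K // w ≠ w₀}, c w'.1 * Real.log (w'.1 (((Additive.toMul x : (𝓞 K)ˣ) : 𝓞 K) : K))) -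
            κ * ∑ w' : {w : InfinitePlace K // w ≠ w₀}, mult w'.1 * Real.log (w'.1 (((Additive.toMul x : (𝓞 K)ˣ) : 𝓞 K) : K)) := by
        rw [Finset.mul_sum, ← Finset.sum_sub_distrib]
        refine Finset.sum_congr rfl fun w' _ ↦ ?_
        simp only [coef]
        field_simp [hm0 w'.1]
      have h2 : ∑ w' : {w : InfinitePlace K // w ≠ w₀}, mult w'.1 * Real.log (w'.1 (((Additive.toMul x : (𝓞 K)ˣ) : 𝓞 K) : K)) =
          -mult (w₀ : InfinitePlace K) * Real.log (w₀ (((Additive.toMul x : (𝓞 K)ˣ) : 𝓞 K) : K)) := by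
        have := sum_logEmbedding_component (Additive.toMul x)
        simpa only [logEmbedding_component] using this
      have h3 : ∑ w' : {w : InfinitePlace K // w ≠ w₀}, c w'.1 * Real.log (w'.1 (((Additive.toMul x : (𝓞 K)ˣ) : 𝓞 K) : K)) =
          -(c w₀ * Real.log (w₀ (((Additive.toMul x : (𝓞 K)ˣ) : 𝓞 K) : K))) := by
        have hsum := hc (Additive.toMul x)
        rw [Fintype.sum_eq_add_sum_subtype_ne _ w₀, add_eq_zero_iff_neg_eq] at hsum
        rw [← hsum]
      rw [h1, h2, h3, ← hκ0]
      ring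
    -- hence `f = 0` (the unit lattice spans the log space)
    have hf0 : f = 0 := by
      have hle : Submodule.span ℝ (unitLattice K : Set (logSpace K)) ≤ LinearMap.ker f :=
        Submodule.span_le.mpr fun y hy ↦ LinearMap.mem_ker.mpr (hf y hy)
      rw [unitLattice_span_eq_top, top_le_iff] at hle
      exact LinearMap.ker_eq_top.mp hle
    -- evaluate at the basis vector of `w`
    have hval := LinearMap.congr_fun hf0 (Pi.single (⟨w, hw⟩ : {w : InfinitePlace K // w ≠ w₀}) 1)
    rw [hf_apply, LinearMap.zero_apply, Finset.sum_eq_single (⟨w, hw⟩ : {w : InfinitePlace K // w ≠ w₀})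
      (fun w' _ hw' ↦ by rw [Pi.single_eq_of_ne hw', mul_zero]) (fun h' ↦ absurd (Finset.mem_univ _) h'),
      Pi.single_eq_same, mul_one] at hval
    simp only [coef, sub_eq_zero] at hval
    rw [← hval, div_mul_cancel₀ _ (hm0 w)]

/-! ### §4. The weight -/

open NumberField.Units.dirichletUnitTheorem in
/-- **Purity of algebraic Hecke characters, place form**: if `χ` has infinity type `(p, q)` there is
an integer `w` (the weight) with `2 (p_v + q_v) = w [K_v : ℝ]` at every infinite place `v`, i.e.
`p_v + q_v = w/2` at real places and `p_v + q_v = w` at complex ones. Patrikis 2019, Lemma 2.1.3 and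
its proof (Weil 1956). [cite: Patrikis2019, Lemma 2.1.3 (arXiv:1207.6724 §2.1)] [cite: Weil1956] -/
theorem HasInfinityType.exists_two_mul_add_eq_weight_mul_mult {χ : HeckeCharacter K}
    {p q : InfinitePlace K → ℤ} (h : χ.HasInfinityType p q) :
    ∃ wt : ℤ, ∀ v : InfinitePlace K, 2 * (p v + q v) = wt * v.mult := by
  obtain ⟨κ, hκ⟩ := exists_eq_mul_mult_of_sum_mul_log_unit_eq_zero
    (fun w ↦ ((p w + q w : ℤ) : ℝ)) h.sum_mul_log_unit_eq_zero
  -- `2 κ` is an integer: read it at `w₀`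
  obtain ⟨wt, hwt⟩ : ∃ wt : ℤ, (wt : ℝ) = 2 * κ := by
    by_cases h0 : (w₀ : InfinitePlace K).IsReal
    · refine ⟨2 * (p w₀ + q w₀), ?_⟩
      have := hκ w₀
      rw [mult, if_pos h0, Nat.cast_one, mul_one] at this
      rw [← this]
      push_cast
      ring
    · refine ⟨p w₀ + q w₀, ?_⟩
      have := hκ w₀
      rw [mult, if_neg h0, Nat.cast_ofNat] at this
      push_cast at this ⊢
      linarith
  refine ⟨wt, fun v ↦ ?_⟩
  have hv : ((p v : ℝ) + q v) = κ * v.mult := by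
    have := hκ v
    push_cast at this
    exact this
  have : ((2 * (p v + q v) : ℤ) : ℝ) = ((wt * v.mult : ℤ) : ℝ) := by
    push_cast
    rw [hv, hwt]
    ring
  exact_mod_cast this

/-- **Purity of algebraic Hecke characters, embedding form**: if `χ` has infinity type `(p, q)` with
exponents `n_φ = embExponent p q φ`, there is an integer `w` with `n_φ + n_{φ̄} = w` for every
embedding `φ : K → ℂ` (`φ̄ = conj ∘ φ`). Patrikis 2019, Lemma 2.1.3 and its proof: "`m_g + m_{c g}`
equals a constant `w` independent of `g`" (Weil 1956). [cite: Patrikis2019, Lemma 2.1.3 (arXiv:1207.6724 §2.1)] [cite: Weil1956] -/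
theorem HasInfinityType.exists_embExponent_add_conjugate_eq {χ : HeckeCharacter K}
    {p q : InfinitePlace K → ℤ} (h : χ.HasInfinityType p q) :
    ∃ wt : ℤ, ∀ φ : K →+* ℂ,
      embExponent p q φ + embExponent p q (ComplexEmbedding.conjugate φ) = wt := by
  obtain ⟨wt, hwt⟩ := h.exists_two_mul_add_eq_weight_mul_mult
  refine ⟨wt, fun φ ↦ ?_⟩
  have hw := hwt (InfinitePlace.mk φ)
  unfold embExponent
  by_cases hφ : ComplexEmbedding.IsReal φ
  · -- real: `φ̄ = φ`, `n_φ = p + q`, `[K_w : ℝ] = 1`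
    have hreal : (InfinitePlace.mk φ).IsReal := ⟨φ, hφ, rfl⟩
    have hconj : ComplexEmbedding.conjugate φ = φ := ComplexEmbedding.isReal_iff.mp hφ
    rw [hconj]
    simp only [hφ, if_true]
    rw [mult, if_pos hreal, Nat.cast_one, mul_one] at hw
    omega
  · have hnreal : ¬ (InfinitePlace.mk φ).IsReal := by
      rw [isReal_iff]
      rcases embedding_mk_eq φ with h' | h'
      · rwa [h']
      · rwa [h', ComplexEmbedding.isReal_conjugate_iff]
    have hφ' : ¬ ComplexEmbedding.IsReal (ComplexEmbedding.conjugate φ) := by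
      rwa [ComplexEmbedding.isReal_conjugate_iff]
    have hne : ComplexEmbedding.conjugate φ ≠ φ := fun h' ↦ hφ (ComplexEmbedding.isReal_iff.mpr h')
    rw [mult, if_neg hnreal, Nat.cast_ofNat] at hw
    simp only [hφ, hφ', if_false, mk_conjugate_eq]
    rcases embedding_mk_eq φ with h' | h'
    · rw [if_pos h'.symm, if_neg (by rw [h']; exact hne)]
      omega
    · rw [if_neg (by rw [h']; exact hne.symm), if_pos h'.symm]
      omega

omit [NumberField K] in
/-- From the embedding form of purity back to the place form: if `n_φ + n_φ̄ = w` for every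
embedding then `2 (p_v + q_v) = w [K_v : ℝ]` at every infinite place (`n_{σ_v} = p_v + q_v` and
`σ̄_v = σ_v` at a real place; `{n_{σ_v}, n_{σ̄_v}} = {p_v, q_v}` at a complex one). [folklore] -/
theorem two_mul_add_eq_weight_mul_mult_of_embExponent {p q : InfinitePlace K → ℤ} {wt : ℤ}
    (hw : ∀ φ : K →+* ℂ, embExponent p q φ + embExponent p q (ComplexEmbedding.conjugate φ) = wt)
    (v : InfinitePlace K) : 2 * (p v + q v) = wt * v.mult := by
  have h := hw v.embedding
  unfold embExponent at h
  rw [mk_conjugate_eq, mk_embedding] at h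
  by_cases hv : v.IsReal
  · have hreal : ComplexEmbedding.IsReal v.embedding := isReal_iff.mp hv
    have hconj : ComplexEmbedding.conjugate v.embedding = v.embedding :=
      conjugate_embedding_eq_of_isReal hv
    rw [hconj] at h
    simp only [hreal, if_true] at h
    rw [mult, if_pos hv, Nat.cast_one, mul_one]
    omega
  · have hnr : ¬ ComplexEmbedding.IsReal v.embedding := fun h' ↦ hv (isReal_iff.mpr h')
    have hnr' : ¬ ComplexEmbedding.IsReal (ComplexEmbedding.conjugate v.embedding) := by
      rwa [ComplexEmbedding.isReal_conjugate_iff]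
    have hne : ComplexEmbedding.conjugate v.embedding ≠ v.embedding := fun h' ↦
      hnr (ComplexEmbedding.isReal_iff.mpr h')
    simp only [hnr, hnr', if_false, if_true, hne] at h
    rw [mult, if_neg hv, Nat.cast_ofNat]
    omega

/-! ### §5. The weight is invariant under `Aut(ℂ)`-conjugation of the type -/

omit [NumberField K] in
/-- `∑_φ n_{σ⁻¹ ∘ φ} = ∑_φ n_φ`: conjugating the type permutes the exponents. [folklore] -/
theorem sum_embExponent_autConjType [NumberField K] (σ : ℂ ≃ₐ[ℚ] ℂ) (p q : InfinitePlace K → ℤ) :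
    ∑ φ : K →+* ℂ, embExponent (autConjType σ p q).1 (autConjType σ p q).2 φ =
      ∑ φ : K →+* ℂ, embExponent p q φ := by
  simp_rw [embExponent_autConjType]
  let e : (K →+* ℂ) ≃ (K →+* ℂ) :=
    { toFun := fun φ ↦ (σ.symm : ℂ ≃ₐ[ℚ] ℂ).toAlgHom.toRingHom.comp φ
      invFun := fun φ ↦ (σ : ℂ ≃ₐ[ℚ] ℂ).toAlgHom.toRingHom.comp φ
      left_inv := fun φ ↦ RingHom.ext fun x ↦ by simp
      right_inv := fun φ ↦ RingHom.ext fun x ↦ by simp }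
  exact Fintype.sum_equiv e _ _ fun φ ↦ rfl

omit [NumberField K] in
/-- `(σ⁻¹ ∘ φ)‾ ` and `σ⁻¹ ∘ φ̄` have the same sum of exponents over all `φ`: both index sets are all
embeddings. [folklore] -/
theorem sum_embExponent_conjugate [NumberField K] (p q : InfinitePlace K → ℤ) :
    ∑ φ : K →+* ℂ, embExponent p q (ComplexEmbedding.conjugate φ) = ∑ φ : K →+* ℂ, embExponent p q φ := by
  let e : (K →+* ℂ) ≃ (K →+* ℂ) :=
    { toFun := ComplexEmbedding.conjugate
      invFun := ComplexEmbedding.conjugate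
      left_inv := fun φ ↦ ComplexEmbedding.involutive_conjugate K φ
      right_inv := fun φ ↦ ComplexEmbedding.involutive_conjugate K φ }
  exact Fintype.sum_equiv e _ _ fun φ ↦ rfl

/-- **The weight is `Aut(ℂ)`-invariant**: if `n_φ + n_φ̄ = w` for the type `(p, q)` and
`n'_φ + n'_φ̄ = w'` for the conjugate type `^σ(p, q)` (`autConjType σ p q`, exponents
`n'_φ = n_{σ⁻¹∘φ}`), then `w' = w` (sum over all `φ`: both equal `2 ∑_φ n_φ / [K : ℚ]`; Patrikis
2019, proof of Lemma 2.1.3, footnote: "`½|G| w_ι = ∑_g m_g`"). [cite: Patrikis2019, proof of Lemma 2.1.3 (arXiv:1207.6724 §2.1, footnote)] -/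
theorem weight_autConjType_eq (σ : ℂ ≃ₐ[ℚ] ℂ) (p q : InfinitePlace K → ℤ) {wt wt' : ℤ}
    (hw : ∀ φ : K →+* ℂ, embExponent p q φ + embExponent p q (ComplexEmbedding.conjugate φ) = wt)
    (hw' : ∀ φ : K →+* ℂ, embExponent (autConjType σ p q).1 (autConjType σ p q).2 φ +
      embExponent (autConjType σ p q).1 (autConjType σ p q).2 (ComplexEmbedding.conjugate φ) = wt') :
    wt' = wt := by
  have hcard : (Fintype.card (K →+* ℂ) : ℤ) ≠ 0 := by
    rw [Embeddings.card]
    exact_mod_cast Module.finrank_pos.ne'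
  have h1 : ∑ φ : K →+* ℂ, (embExponent p q φ + embExponent p q (ComplexEmbedding.conjugate φ)) =
      Fintype.card (K →+* ℂ) * wt := by
    rw [Finset.sum_congr rfl fun φ _ ↦ hw φ, Finset.sum_const, Finset.card_univ, nsmul_eq_mul]
  have h2 : ∑ φ : K →+* ℂ, (embExponent (autConjType σ p q).1 (autConjType σ p q).2 φ +
      embExponent (autConjType σ p q).1 (autConjType σ p q).2 (ComplexEmbedding.conjugate φ)) =
      Fintype.card (K →+* ℂ) * wt' := by
    rw [Finset.sum_congr rfl fun φ _ ↦ hw' φ, Finset.sum_const, Finset.card_univ, nsmul_eq_mul]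
  rw [Finset.sum_add_distrib, sum_embExponent_conjugate] at h1 h2
  rw [sum_embExponent_autConjType] at h2
  have : (Fintype.card (K →+* ℂ) : ℤ) * wt' = Fintype.card (K →+* ℂ) * wt := by rw [← h1, ← h2]
  exact mul_left_cancel₀ hcard this

/-- **The conjugates `^σχ` have the weight of `χ`**: if `χ` has infinity type `(p, q)` of weight
`w` (`n_φ + n_φ̄ = w`), then the exponents of `^σ(p, q)` — the infinity type of `^σχ`
(`HasInfinityType.hasInfinityType_autConj`) — satisfy `n'_φ + n'_φ̄ = w` as well.
[cite: Patrikis2019, Lemma 2.1.3 (arXiv:1207.6724 §2.1)] -/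
theorem HasInfinityType.embExponent_autConjType_add_conjugate_eq {χ : HeckeCharacter K}
    {p q : InfinitePlace K → ℤ} (h : χ.HasInfinityType p q) (σ : ℂ ≃ₐ[ℚ] ℂ) {wt : ℤ}
    (hw : ∀ φ : K →+* ℂ, embExponent p q φ + embExponent p q (ComplexEmbedding.conjugate φ) = wt)
    (φ : K →+* ℂ) :
    embExponent (autConjType σ p q).1 (autConjType σ p q).2 φ +
      embExponent (autConjType σ p q).1 (autConjType σ p q).2 (ComplexEmbedding.conjugate φ) = wt := by
  obtain ⟨wt', hwt'⟩ := (h.hasInfinityType_autConj σ).exists_embExponent_add_conjugate_eq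
  rw [hwt' φ, weight_autConjType_eq σ p q hw hwt']

end HeckeCharacter

end Literature.NumberTheory.GaloisRepresentations
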